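import Mathlib
import Summits.Ventures.HodgeRepro.Tier4.Common.AdelicRTF
import Summits.Ventures.HodgeRepro.Tier4.Line4.TwoTorusCut
import Summits.Ventures.HodgeRepro.Tier4.Line4.TwoTorusSpectral
import Summits.Ventures.HodgeRepro.Tier4.Line4.ThetaEquivariance

/-!
# Tier4/Line4/GeometricSide — W5's object, typed: the DEFINED double period `RTFData.Jc` unfolds into the folded
orbital integrals `RTFData.orbitalc` over the rational points (Theorem A of proofs/t4/L4/W5-GeometricSide.md), and
W4 / W5 restated on `Jc` (no free `J`)

Blind re-derivation cell `pub-hodge-repro`, Tier 4 «prove the step» (README §9–§10), seat t4-L4-p2 (gen 2; lead g385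
cut S13064 (5): W4 / W5 of decomposition A).  Tree path `lean/Summits/Ventures/HodgeRepro/Tier4/Line4/GeometricSide.lean`.
Imports `Common/AdelicRTF` (`kernel`, `periodLin`, `RTFData`, `Jc`, `orbitalc`, `chi'conj`), `Line4/TwoTorusCut`
(`IsAdmissible`, `HasNonzeroMixedPeriod`), `Line4/TwoTorusSpectral` (`IsTwoTorusSpectralExpansion`, the rung) and
t4-L4-p1's `Line4/ThetaEquivariance` (p674027) for `countable_rationalPoints` (`G(k)` is countable), consumed by name.

WHAT IS PROVED.  **Theorem A** `Jc_eq_tsum_orbitalc`: `R.Jc f = ∑' γ : G(k), R.orbitalc γ f` — the «calcul formel usuel» of Jacquet 1986 §0.2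
(Ann. ENS 19 pp. 186–187, lit-1 row I-t4-lit-1-17: «nous avons ignoré les problèmes de convergence») made exact, with
every convergence hypothesis DISPLAYED ((A0)–(A4) of the paper proof: integrability of the inner and outer integrands
over the fundamental domains and summability of their `L¹`-norms over `G(k)`).  W4 / W5 ON `Jc`: the rung
`exists_admissible_mixed_of_Jc_spectral` is `TwoTorusSpectral.exists_admissible_mixed_of_spectral` at `J := R.Jc f`,
and `exists_admissible_mixed_of_geometric` takes W5 in its geometric form «`∑' γ, R.orbitalc γ f ≠ 0`».

WHAT IS NOT.  Nothing asserts any of (A0)–(A4) (they hold for test functions when `G(k)` is discrete in `G(𝔸)` and the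
torus quotients are compact — not in the tree), nothing asserts the spectral expansion W4, nothing asserts `Jc f ≠ 0`.
The wall `mixed_two_torus_W3` stays the declared wall; W5's residual is now «a DEFINED sum of DEFINED orbital
integrals is non-zero» (paper proof §5 for what that needs).  HC_CM is NOT proved by anyone in this repository.
-/

set_option autoImplicit false

noncomputable section

namespace Summit.Ventures.HodgeRepro.Tier4.Line4

open Summit.Ventures.HodgeRepro.Tier4.Common MeasureTheory NumberField


section TheoremA

variable {k : Type} [Field k] [NumberField k] (W : PlaneData k)
  [MeasurableSpace (torusT W)] [MeasurableSpace (torusT' W)] (R : RTFData W)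

/-- The inner integrand of the folded orbital integral: `t′ ↦ conj χ′(t′) · f(t⁻¹ γ t′)`. -/
def innerFn (f : GA W → ℂ) (γ : GA W) (t : torusT W) : torusT' W → ℂ :=
  fun t' => R.chi'conj t' * f ((t : GA W)⁻¹ * γ * (t' : GA W))

/-- The inner integral `I_γ(t) = ∫_{D_{T′}} conj χ′(t′) f(t⁻¹ γ t′) dμ_{T′}`. -/
def innerInt (f : GA W → ℂ) (γ : GA W) (t : torusT W) : ℂ :=
  ∫ t' in R.DT', innerFn W R f γ t t' ∂(R.μT')

/-- The folded orbital integral is the iterated integral over the two fundamental domains, once the inner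
integrand is integrable on `D_{T′}` for every `t` and the outer one on `D_T`. -/
theorem orbitalc_eq_integral (f : GA W → ℂ) (γ : GA W)
    (h1 : ∀ t : torusT W, Integrable (innerFn W R f γ t) (R.μT'.restrict R.DT'))
    (h3 : Integrable (fun t : torusT W => R.chi t * innerInt W R f γ t) (R.μT.restrict R.DT)) :
    R.orbitalc γ f = ∫ t in R.DT, R.chi t * innerInt W R f γ t ∂(R.μT) := by
  unfold RTFData.orbitalc RTFData.periodT RTFData.periodT'conj
  have hin : ∀ t : torusT W, periodLin W R.μT' R.DT' R.chi'conj
      (fun t' : torusT' W => f ((t : GA W)⁻¹ * γ * (t' : GA W))) = innerInt W R f γ t := by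
    intro t
    exact periodLin_eq_integral W R.μT' R.DT' R.chi'conj (h1 t)
  simp only [hin]
  exact periodLin_eq_integral W R.μT R.DT R.chi h3

/-- **Theorem A — the kernel unfolds into the folded orbital integrals over `G(k)`** (Jacquet 1986 §0.2, the formal
computation made exact): `Jc f = ∑' γ ∈ G(k), orbitalc γ f`.  DISPLAYED hypotheses: (A0) the kernel integrands are
integrable over the fundamental domains; (A1)–(A4) the orbital integrands are integrable with summable `L¹`-norms over
`G(k)` (inner, for every `t`; outer).  Nothing asserts any of them. -/
theorem Jc_eq_tsum_orbitalc (f : GA W → ℂ)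
    (hA0 : ∀ t : torusT W, Integrable (fun t' : torusT' W => R.chi'conj t' * kernel W f (t : GA W) (t' : GA W))
      (R.μT'.restrict R.DT'))
    (hA0' : Integrable (fun t : torusT W => R.chi t *
      ∫ t' in R.DT', R.chi'conj t' * kernel W f (t : GA W) (t' : GA W) ∂(R.μT')) (R.μT.restrict R.DT))
    (hA1 : ∀ (γ : rationalPoints W) (t : torusT W),
      Integrable (innerFn W R f (γ : GA W) t) (R.μT'.restrict R.DT'))
    (hA2 : ∀ t : torusT W, Summable (fun γ : rationalPoints W =>
      ∫ t' in R.DT', ‖innerFn W R f (γ : GA W) t t'‖ ∂(R.μT')))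
    (hA3 : ∀ γ : rationalPoints W,
      Integrable (fun t : torusT W => R.chi t * innerInt W R f (γ : GA W) t) (R.μT.restrict R.DT))
    (hA4 : Summable (fun γ : rationalPoints W =>
      ∫ t in R.DT, ‖R.chi t * innerInt W R f (γ : GA W) t‖ ∂(R.μT))) :
    R.Jc f = ∑' γ : rationalPoints W, R.orbitalc (γ : GA W) f := by
  haveI hcnt := countable_rationalPoints W
  -- the inner period of the kernel is the sum of the inner orbital integrals
  have hinner : ∀ t : torusT W,
      R.periodT'conj (fun t' : torusT' W => kernel W f (t : GA W) (t' : GA W)) =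
        ∑' γ : rationalPoints W, innerInt W R f (γ : GA W) t := by
    intro t
    unfold RTFData.periodT'conj
    rw [periodLin_eq_integral W R.μT' R.DT' R.chi'conj (hA0 t)]
    have hfun : (fun t' : torusT' W => R.chi'conj t' * kernel W f (t : GA W) (t' : GA W)) =
        fun t' => ∑' γ : rationalPoints W, innerFn W R f (γ : GA W) t t' := by
      funext t'
      unfold kernel innerFn
      rw [tsum_mul_left]
    rw [hfun]
    unfold innerInt
    exact (integral_tsum_of_summable_integral_norm (hA1 · t) (hA2 t)).symm
  -- the outer period
  unfold RTFData.Jc RTFData.periodT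
  rw [periodLin_eq_integral W R.μT R.DT R.chi (by
    have : (fun t : torusT W => R.chi t * R.periodT'conj
        (fun t' : torusT' W => kernel W f (t : GA W) (t' : GA W))) =
        fun t : torusT W => R.chi t * ∫ t' in R.DT', R.chi'conj t' * kernel W f (t : GA W) (t' : GA W) ∂(R.μT') := by
      funext t
      unfold RTFData.periodT'conj
      rw [periodLin_eq_integral W R.μT' R.DT' R.chi'conj (hA0 t)]
    rw [this]
    exact hA0')]
  have hfun : (fun t : torusT W => R.chi t * R.periodT'conj
      (fun t' : torusT' W => kernel W f (t : GA W) (t' : GA W))) =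
      fun t => ∑' γ : rationalPoints W, R.chi t * innerInt W R f (γ : GA W) t := by
    funext t
    rw [hinner t, tsum_mul_left]
  rw [hfun, ← integral_tsum_of_summable_integral_norm hA3 hA4]
  refine tsum_congr fun γ => ?_
  exact (orbitalc_eq_integral W R f (γ : GA W) (hA1 γ) (hA3 γ)).symm

end TheoremA

section W4W5

variable {k : Type} [Field k] [NumberField k] (W : PlaneData k)
  [MeasurableSpace (torusT W)] [MeasurableSpace (torusT' W)] (R : RTFData W)

/-- **W4 ∧ W5 → W3 with `J := Jc f`** (no free number): a spectral expansion of the DEFINED double period `R.Jc f`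
over a family of admissible subspaces (W4 on `Jc`) together with `R.Jc f ≠ 0` (W5 on `Jc`) gives the narrowed wall
W3.  Both hypotheses stay displayed automorphic inputs. -/
theorem exists_admissible_mixed_of_Jc_spectral [MeasurableSpace (GA W)] (μ : Measure (GA W)) (f : GA W → ℂ)
    {n : ℕ} (V : Fin n → Submodule ℂ (GA W → ℂ)) (lam : Fin n → ℂ) (v' : Fin n → (GA W → ℂ))
    (q : QuadData k) (g g' : Matrix (Fin 4) (Fin 4) k) (w₀ : InfinitePlace k) (eP eM eP' eM' : InfinitePlace k → ℤ)
    (hadm : ∀ i, IsAdmissible W q g g' w₀ eP eM eP' eM' (V i))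
    (hS : IsTwoTorusSpectralExpansion W R μ f (R.Jc f) V lam v') (hJ : R.Jc f ≠ 0) :
    ∃ V₀ : Submodule ℂ (GA W → ℂ), IsAdmissible W q g g' w₀ eP eM eP' eM' V₀ ∧ HasNonzeroMixedPeriod W R V₀ :=
  exists_admissible_mixed_of_spectral W R μ f (R.Jc f) V lam v' q g g' w₀ eP eM eP' eM' hadm hS hJ

/-- **W5 in its GEOMETRIC form**: under the convergence hypotheses of Theorem A, a non-zero sum of folded orbital
integrals over `G(k)` is a non-zero `Jc f`, hence (with W4 on `Jc`) the narrowed wall W3. -/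
theorem exists_admissible_mixed_of_geometric [MeasurableSpace (GA W)] (μ : Measure (GA W)) (f : GA W → ℂ)
    {n : ℕ} (V : Fin n → Submodule ℂ (GA W → ℂ)) (lam : Fin n → ℂ) (v' : Fin n → (GA W → ℂ))
    (q : QuadData k) (g g' : Matrix (Fin 4) (Fin 4) k) (w₀ : InfinitePlace k) (eP eM eP' eM' : InfinitePlace k → ℤ)
    (hadm : ∀ i, IsAdmissible W q g g' w₀ eP eM eP' eM' (V i))
    (hS : IsTwoTorusSpectralExpansion W R μ f (R.Jc f) V lam v')
    (hA0 : ∀ t : torusT W, Integrable (fun t' : torusT' W => R.chi'conj t' * kernel W f (t : GA W) (t' : GA W))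
      (R.μT'.restrict R.DT'))
    (hA0' : Integrable (fun t : torusT W => R.chi t *
      ∫ t' in R.DT', R.chi'conj t' * kernel W f (t : GA W) (t' : GA W) ∂(R.μT')) (R.μT.restrict R.DT))
    (hA1 : ∀ (γ : rationalPoints W) (t : torusT W),
      Integrable (innerFn W R f (γ : GA W) t) (R.μT'.restrict R.DT'))
    (hA2 : ∀ t : torusT W, Summable (fun γ : rationalPoints W =>
      ∫ t' in R.DT', ‖innerFn W R f (γ : GA W) t t'‖ ∂(R.μT')))
    (hA3 : ∀ γ : rationalPoints W,
      Integrable (fun t : torusT W => R.chi t * innerInt W R f (γ : GA W) t) (R.μT.restrict R.DT))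
    (hA4 : Summable (fun γ : rationalPoints W =>
      ∫ t in R.DT, ‖R.chi t * innerInt W R f (γ : GA W) t‖ ∂(R.μT)))
    (hgeom : (∑' γ : rationalPoints W, R.orbitalc (γ : GA W) f) ≠ 0) :
    ∃ V₀ : Submodule ℂ (GA W → ℂ), IsAdmissible W q g g' w₀ eP eM eP' eM' V₀ ∧ HasNonzeroMixedPeriod W R V₀ := by
  refine exists_admissible_mixed_of_Jc_spectral W R μ f V lam v' q g g' w₀ eP eM eP' eM' hadm hS ?_
  rw [Jc_eq_tsum_orbitalc W R f hA0 hA0' hA1 hA2 hA3 hA4]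
  exact hgeom

end W4W5

end Summit.Ventures.HodgeRepro.Tier4.Line4

end
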